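import Summits.RiemannHypothesis.RiemannHypothesis.Theorems.Splittings.LinearRayLehmerWindowDefs

/-!
# The linear-factor ray at Lehmer's pair — compiled certificate 3/3: forward averages, `4 ≤ a ≤ 21`

Cell rh-split (D-0116 arm), ENGINE 5 (rh-splitx-eng-5 g4), lane (xviii-D) «LEHMER WINDOW DATA».
The forward-average check `ldQRun 20 35 ldAsHigh 1000 9 250 219000`: the engine's forward point data
(`hiPointData C 20 0 35`: 35 cells of half-width `1/20` after `t₀`, 560 certified `ζ` evaluations — the
point data of the engine's own `hiWin2_check`), boxes `ldAsHigh/1000 = [4, 5, …, 20, 20.5, 21]`, and per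
box the margin `(9/250)·219000 < e^{−a₂·9/250}·q` — evaluated ONCE by `native_decide` (declared
computational axiom `ldHigh_check`).  Design numbers: last box `[20.5, 21]`: `q = 17672`,
`e^{−0.756}·q = 8298 > 7884 = L·M`; the next box `[21, 21.5]` fails (`7376 < 7884`), whence the window
end `a = 21`.  Soundness: `ldQRunWith_sound` (file `LinearRayLehmerWindowQ.lean`).
HONEST LABEL: RH-free negative-side bookkeeping on the linear-factor ray; nothing here bears on the truth of RH.
-/

set_option linter.dupNamespace false

namespace Summit.RiemannHypothesis.RiemannHypothesis.Theorems.Splittings.LinearRayLehmerWindow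

/-- **The compiled forward-average check, high window** (`native_decide`). [folklore] -/
theorem ldHigh_check : ldQRun 20 35 ldAsHigh 1000 9 250 219000 = true := by
  native_decide

end Summit.RiemannHypothesis.RiemannHypothesis.Theorems.Splittings.LinearRayLehmerWindow
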